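import Summits.ResolutionOfSingularities.ResolutionOfSingularities.Theorems.WildConesCampaignW46HypersurfacesCharTwoHilbertWitness
import Summits.ResolutionOfSingularities.ResolutionOfSingularities.Theorems.WildConesCampaignW46HypersurfacesCharTwoNullPolar

/-!
# [OURS · L1 W4.6, rung (ii) at p = 2, HONEST SCOPE MARKER, n = 4 — LEAF COMPUTATIONS] the order-2-cleaned fourfold
# double point `z² = u₀u₁ + u₂³ + t·u₂u₃² + u₃⁵`: coefficients, order, partials, gradient ideal ⊇ 𝔪⁵ (isolated),
# polar matrix (kernel `{v₀ = v₁ = 0}`), polars `λ₂(v₂² + t v₃²)`, tangent cubic `w₂³ + t·w₂w₃²` — used by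
# `…FourfoldImperfect.lean` (over an IMPERFECT field, `t` a non-square: exactly one near double point, free, no satellite)

HONEST FRAMING. Everything here is OURS: an explicit computation in route WildCones' TYPED point-blow-up dynamics
(`Theorems/WildConesClassicalRegimesDefs.lean`), in the pattern of the seat's witnesses
`…HypersurfacesCharTwo{FourfoldMixed,HilbertWitness,FourfoldThreeTangents}.lean` (p507619, p517132, p560817). NOTHING here
is a statement of the manuscript [Hironaka2017]; no FACT-LIST premise; AI review is weaker than expert review. Cell
res-hironaka (LADDER-RESOLUTION rung L, D-0089), slot W4.6, seat res-L1-s46-pv-4 (gen 7); host route `WildCones`, crux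
`ClassicalRegimes` (stmt-ResolutionOfSingularities-16884; proved). CAVEAT (as in every file of this seat): over a
non-perfect field the «cleaning» and the translations `τ ∈ κⁿ` are the FORMAL dynamics of the route; a non-rational
closed point of the exceptional divisor (here the satellite, with residue field `κ(√t)`) is not visited by them.

WHY. Over a PERFECT field the `(2,2)` census is «exactly one satellite + at most one free point» (p538084, p549448,
census rev 2 `…HilbertTwoExactCount`); gen 7 showed over EVERY field that the null polar `[λ₀]` is a near point and is
THE free point unless it is the satellite (`…NullPolarNear`). Here the remaining possibility is INHABITED: for
`a = u₀u₁ + u₂³ + t·u₂u₃² + u₃⁵` the kernel of the polar form is `{v₀ = v₁ = 0}`, the polars there are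
`polar(λ, v) = λ₂(v₂² + t·v₃²)` (so `N = κe₃`, `h₂ = 2`), and the tangent cubic is `w₂(w₂² + t·w₃²)`: if `t` is not
a square its only rational projective root on the kernel line is `[e₃] = N`, which is FREE (`polar(e₂, e₃) = t ≠ 0`).
So: exactly one infinitely-near double point, of corank `0` (isolated, `μ = 1`, nothing after it), and NO corank-`2`
successor — impossible over a perfect field. Non-vacuity over `𝔽₂(X)` with `t = X` (odd degree, not a square).

WHAT IS PROVED (`κ` any field of characteristic `2`, `t ∈ κ`, unless marked):

* leaf lemmas for `u₀u₁ + u₂³ + t·u₂u₃² + u₃⁵`: coefficients, `MultP`, `OrdP`, partials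
  `(u₁, u₀, u₂² + t·u₃², u₃⁴)`, `𝔪⁵ ≤ (∂a)` (`Isol`), polar matrix (kernel `{v₀ = v₁ = 0}` exactly), polars
  `λ₂(v₂² + t v₃²)`, tangent cubic `w₂³ + t·w₂w₃²`;
* the census itself (`fourImp_invariants`, `fourImp_multP_step_iff`, `fourImp_census_of_not_square`,
  `fourfold_imperfect_witness_ratFunc`) is in `…FourfoldImperfect.lean`.

References: [GreuelPfister2026] (context); [CasasAlvero2000] §3 (names free/satellite: context); [Hironaka2017]
Th. 16.6 p.84 — role replaced only, under adjudication; nothing of it is used.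
-/

noncomputable section

-- single-problem summit: the doubled namespace component `ResolutionOfSingularities` is forced
set_option linter.dupNamespace false

open scoped BigOperators Classical

open MvPowerSeries IsLocalRing

open Literature.AlgebraicGeometry.Resolution

namespace Summit.ResolutionOfSingularities.ResolutionOfSingularities.Theorems

namespace CampaignW46.HypersurfacesCharTwo

open WildCones WildCones.MuDropCharTwoOrdP ThreefoldsCharTwo

variable {κ : Type} [Field κ]

/-! ## The state `u₀u₁ + u₂³ + t·u₂u₃² + u₃⁵`: coefficients, order, partials -/

/-- Coefficients of `X₀X₁ + X₂³ + t·X₂X₃² + X₃⁵`. [folklore] -/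
theorem coeff_fourImp (t : κ) (A : Fin 4 →₀ ℕ) :
    coeff A ((X 0 * X 1 + X 2 ^ 3 + t • (X 2 * X 3 ^ 2) + X 3 ^ 5 : MvPowerSeries (Fin 4) κ)) =
      (if A = Finsupp.single 0 1 + Finsupp.single 1 1 then 1 else 0) +
        (if A = Finsupp.single 2 3 then 1 else 0) +
        t * (if A = Finsupp.single 2 1 + Finsupp.single 3 2 then 1 else 0) +
        (if A = Finsupp.single 3 5 then 1 else 0) := by
  rw [map_add, map_add, map_add, map_smul, X_pow_eq, X_pow_eq, X_pow_eq, X_def, X_def, X_def,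
    monomial_mul_monomial, monomial_mul_monomial, one_mul, coeff_monomial, coeff_monomial, coeff_monomial,
    coeff_monomial, smul_eq_mul]

/-- The series has no monomial with all exponents even. [folklore] -/
theorem fourImp_coeff_eq_zero_of_even (t : κ) (A : Fin 4 →₀ ℕ) (hA : ∀ j, 2 ∣ A j) :
    coeff A ((X 0 * X 1 + X 2 ^ 3 + t • (X 2 * X 3 ^ 2) + X 3 ^ 5 : MvPowerSeries (Fin 4) κ)) = 0 := by
  rw [coeff_fourImp]
  have h0 : A ≠ Finsupp.single 0 1 + Finsupp.single 1 1 := by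
    rintro rfl; have := hA 0; simp at this
  have h1 : A ≠ Finsupp.single 2 3 := by
    rintro rfl; have := hA 2; simp at this
  have h2 : A ≠ Finsupp.single 2 1 + Finsupp.single 3 2 := by
    rintro rfl; have := hA 2; simp at this
  have h3 : A ≠ Finsupp.single 3 5 := by
    rintro rfl; have := hA 3; simp at this
  rw [if_neg h0, if_neg h1, if_neg h2, if_neg h3]
  simp

/-- The pair coefficient `[X₀X₁]` is `1`. [folklore] -/
theorem coeff_pair_fourImp (t : κ) :
    coeff (Finsupp.single 0 1 + Finsupp.single 1 1)
      ((X 0 * X 1 + X 2 ^ 3 + t • (X 2 * X 3 ^ 2) + X 3 ^ 5 : MvPowerSeries (Fin 4) κ)) = 1 := by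
  rw [coeff_fourImp, if_pos rfl]
  have h1 : (Finsupp.single 0 1 + Finsupp.single 1 1 : Fin 4 →₀ ℕ) ≠ Finsupp.single 2 3 := by
    intro h'; have := DFunLike.congr_fun h' 0; simp at this
  have h2 : (Finsupp.single 0 1 + Finsupp.single 1 1 : Fin 4 →₀ ℕ) ≠
      Finsupp.single 2 1 + Finsupp.single 3 2 := by
    intro h'; have := DFunLike.congr_fun h' 0; simp at this
  have h3 : (Finsupp.single 0 1 + Finsupp.single 1 1 : Fin 4 →₀ ℕ) ≠ Finsupp.single 3 5 := by
    intro h'; have := DFunLike.congr_fun h' 0; simp at this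
  rw [if_neg h1, if_neg h2, if_neg h3]
  simp

/-- [OURS · L1 W4.6] A state (`n = 4`) with cleaned series `u₀u₁ + u₂³ + t·u₂u₃² + u₃⁵` is a double point.
[folklore] -/
theorem multP_of_ser_eq_fourImp {t : κ} {c : (Fin 4 → ℕ) → κ}
    (hc : ser 2 4 κ c = X 0 * X 1 + X 2 ^ 3 + t • (X 2 * X 3 ^ 2) + X 3 ^ 5) : MultP 2 4 κ c := by
  rw [multP_iff_ser, hc]
  constructor
  · intro h
    have h1 := congrArg (coeff (Finsupp.single (0 : Fin 4) 1 + Finsupp.single 1 1)) h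
    rw [coeff_pair_fourImp, map_zero] at h1
    exact one_ne_zero h1
  · refine nat_le_order fun d hd => ?_
    rw [coeff_fourImp]
    have h0 : d ≠ Finsupp.single 0 1 + Finsupp.single 1 1 := by
      rintro rfl; simp only [map_add, Finsupp.degree_single] at hd; omega
    have h1 : d ≠ Finsupp.single 2 3 := by
      rintro rfl; simp only [Finsupp.degree_single] at hd; omega
    have h2 : d ≠ Finsupp.single 2 1 + Finsupp.single 3 2 := by
      rintro rfl; simp only [map_add, Finsupp.degree_single] at hd; omega
    have h3 : d ≠ Finsupp.single 3 5 := by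
      rintro rfl; simp only [Finsupp.degree_single] at hd; omega
    rw [if_neg h0, if_neg h1, if_neg h2, if_neg h3]
    simp

/-- [OURS · L1 W4.6] … and order-2 cleaned (`u₀u₁`). [folklore] -/
theorem ordP_of_ser_eq_fourImp {t : κ} {c : (Fin 4 → ℕ) → κ}
    (hc : ser 2 4 κ c = X 0 * X 1 + X 2 ^ 3 + t • (X 2 * X 3 ^ 2) + X 3 ^ 5) : OrdP 2 4 κ c := by
  rw [ordP_two_iff_exists_pair, hc]
  exact ⟨0, 1, by decide, by rw [coeff_pair_fourImp]; exact one_ne_zero⟩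

/-- In characteristic two: `∂₀ a = X₁`, `∂₁ a = X₀`, `∂₂ a = X₂² + t·X₃²`, `∂₃ a = X₃⁴`. [folklore] -/
theorem pderiv_fourImp [CharP κ 2] (t : κ) (s : Fin 4) :
    MvPowerSeries.pderiv s ((X 0 * X 1 + X 2 ^ 3 + t • (X 2 * X 3 ^ 2) + X 3 ^ 5 : MvPowerSeries (Fin 4) κ)) =
      if s = 0 then X 1 else if s = 1 then X 0 else if s = 2 then X 2 ^ 2 + t • X 3 ^ 2 else X 3 ^ 4 := by
  have h2 : (2 : MvPowerSeries (Fin 4) κ) = 0 := by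
    rw [← map_ofNat (C : κ →+* _) 2, CharTwo.two_eq_zero, map_zero]
  have h3 : (3 : MvPowerSeries (Fin 4) κ) = 1 := by
    rw [show (3 : MvPowerSeries (Fin 4) κ) = 2 + 1 by norm_num, h2, zero_add]
  have h5 : (5 : MvPowerSeries (Fin 4) κ) = 1 := by
    rw [show (5 : MvPowerSeries (Fin 4) κ) = 2 + 2 + 1 by norm_num, h2, zero_add, zero_add]
  rw [map_add, map_add, map_add, Derivation.map_smul, Derivation.leibniz, Derivation.leibniz,
    Derivation.leibniz_pow, Derivation.leibniz_pow, Derivation.leibniz_pow, MvPowerSeries.pderiv_X,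
    MvPowerSeries.pderiv_X, MvPowerSeries.pderiv_X, MvPowerSeries.pderiv_X]
  fin_cases s <;> simp [smul_eq_mul, h2, h3, h5]

/-- The gradient ideal contains `X₀`, `X₁`, `X₂² + t·X₃²`, `X₃⁴` (characteristic two). [folklore] -/
theorem mem_jac_fourImp [CharP κ 2] (t : κ) :
    (X 0 : MvPowerSeries (Fin 4) κ) ∈ Ideal.span (Set.range fun s : Fin 4 =>
        MvPowerSeries.pderiv s ((X 0 * X 1 + X 2 ^ 3 + t • (X 2 * X 3 ^ 2) + X 3 ^ 5 : MvPowerSeries (Fin 4) κ))) ∧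
    (X 1 : MvPowerSeries (Fin 4) κ) ∈ Ideal.span (Set.range fun s : Fin 4 =>
        MvPowerSeries.pderiv s ((X 0 * X 1 + X 2 ^ 3 + t • (X 2 * X 3 ^ 2) + X 3 ^ 5 : MvPowerSeries (Fin 4) κ))) ∧
    (X 2 : MvPowerSeries (Fin 4) κ) ^ 2 + t • X 3 ^ 2 ∈ Ideal.span (Set.range fun s : Fin 4 =>
        MvPowerSeries.pderiv s ((X 0 * X 1 + X 2 ^ 3 + t • (X 2 * X 3 ^ 2) + X 3 ^ 5 : MvPowerSeries (Fin 4) κ))) ∧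
    (X 3 : MvPowerSeries (Fin 4) κ) ^ 4 ∈ Ideal.span (Set.range fun s : Fin 4 =>
        MvPowerSeries.pderiv s ((X 0 * X 1 + X 2 ^ 3 + t • (X 2 * X 3 ^ 2) + X 3 ^ 5 : MvPowerSeries (Fin 4) κ))) := by
  refine ⟨?_, ?_, ?_, ?_⟩
  · refine Ideal.subset_span ⟨1, ?_⟩
    simp only [pderiv_fourImp]; simp
  · refine Ideal.subset_span ⟨0, ?_⟩
    simp only [pderiv_fourImp]; simp
  · refine Ideal.subset_span ⟨2, ?_⟩
    simp only [pderiv_fourImp]; simp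
  · refine Ideal.subset_span ⟨3, ?_⟩
    simp only [pderiv_fourImp]; simp

/-- `𝔪⁵ ≤ (∂a)`: with `X₀, X₁, X₃⁴ ∈ (∂a)` and `X₂⁴ = (X₂² + tX₃²)(X₂² + tX₃²) + t²X₃⁴`,
`X₂²X₃² = (X₂² + tX₃²)X₃² + tX₃⁴` (characteristic two), every monomial of degree `5` lies in `(∂a)`. [folklore] -/
theorem maximalIdeal_pow_five_le_jac_fourImp [CharP κ 2] (t : κ) :
    maximalIdeal (MvPowerSeries (Fin 4) κ) ^ 5 ≤
      Ideal.span (Set.range fun s : Fin 4 =>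
        MvPowerSeries.pderiv s ((X 0 * X 1 + X 2 ^ 3 + t • (X 2 * X 3 ^ 2) + X 3 ^ 5 : MvPowerSeries (Fin 4) κ))) := by
  set J := Ideal.span (Set.range fun s : Fin 4 =>
    MvPowerSeries.pderiv s ((X 0 * X 1 + X 2 ^ 3 + t • (X 2 * X 3 ^ 2) + X 3 ^ 5 : MvPowerSeries (Fin 4) κ))) with hJ
  obtain ⟨hX0, hX1, hQ, hX3⟩ := mem_jac_fourImp (κ := κ) t
  -- the two derived members
  have hX22 : (X 2 : MvPowerSeries (Fin 4) κ) ^ 2 * X 3 ^ 2 ∈ J := by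
    have h : (X 2 : MvPowerSeries (Fin 4) κ) ^ 2 * X 3 ^ 2 = (X 2 ^ 2 + t • X 3 ^ 2) * X 3 ^ 2 - t • X 3 ^ 4 := by
      rw [add_mul, smul_mul_assoc, ← pow_add]
      ring
    rw [h]
    exact Ideal.sub_mem _ (Ideal.mul_mem_right _ _ hQ) (Submodule.smul_of_tower_mem _ t hX3)
  have hX24 : (X 2 : MvPowerSeries (Fin 4) κ) ^ 4 ∈ J := by
    have h : (X 2 : MvPowerSeries (Fin 4) κ) ^ 4 =
        (X 2 ^ 2 + t • X 3 ^ 2) * X 2 ^ 2 - t • (X 2 ^ 2 * X 3 ^ 2) := by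
      rw [add_mul, smul_mul_assoc, ← pow_add]
      ring
    rw [h]
    exact Ideal.sub_mem _ (Ideal.mul_mem_right _ _ hQ) (Submodule.smul_of_tower_mem _ t hX22)
  -- monomials: divisibility by a member
  have mem_of : ∀ (B e : Fin 4 →₀ ℕ), B ≤ e → (monomial B (1 : κ) : MvPowerSeries (Fin 4) κ) ∈ J →
      (monomial e (1 : κ) : MvPowerSeries (Fin 4) κ) ∈ J := by
    intro B e hBe hB
    have hdec : (monomial e (1 : κ) : MvPowerSeries (Fin 4) κ) = monomial (e - B) (1 : κ) * monomial B (1 : κ) := by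
      rw [monomial_mul_monomial, one_mul, tsub_add_cancel_of_le hBe]
    rw [hdec]
    exact Ideal.mul_mem_left _ _ hB
  have hm0 : (monomial (Finsupp.single 0 1) (1 : κ) : MvPowerSeries (Fin 4) κ) ∈ J := by rw [← X_def]; exact hX0
  have hm1 : (monomial (Finsupp.single 1 1) (1 : κ) : MvPowerSeries (Fin 4) κ) ∈ J := by rw [← X_def]; exact hX1
  have hm3 : (monomial (Finsupp.single 3 4) (1 : κ) : MvPowerSeries (Fin 4) κ) ∈ J := by rw [← X_pow_eq]; exact hX3
  have hm2 : (monomial (Finsupp.single 2 4) (1 : κ) : MvPowerSeries (Fin 4) κ) ∈ J := by rw [← X_pow_eq]; exact hX24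
  have hm23 : (monomial (Finsupp.single 2 2 + Finsupp.single 3 2) (1 : κ) : MvPowerSeries (Fin 4) κ) ∈ J := by
    have h : (monomial (Finsupp.single 2 2 + Finsupp.single 3 2) (1 : κ) : MvPowerSeries (Fin 4) κ) =
        X 2 ^ 2 * X 3 ^ 2 := by
      rw [X_pow_eq, X_pow_eq, monomial_mul_monomial, one_mul]
    rw [h]; exact hX22
  rw [Literature.RingTheory.MvPowerSeries.Jets.maximalIdeal_pow_eq_span_monomial, Ideal.span_le]
  rintro _ ⟨e, he, rfl⟩
  change e.degree = 5 at he
  change (monomial e (1 : κ) : MvPowerSeries (Fin 4) κ) ∈ J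
  by_cases h0 : 1 ≤ e 0
  · exact mem_of _ _ (Finsupp.single_le_iff.mpr h0) hm0
  by_cases h1 : 1 ≤ e 1
  · exact mem_of _ _ (Finsupp.single_le_iff.mpr h1) hm1
  have hsum : e.degree = e 0 + e 1 + e 2 + e 3 := by
    rw [degree_eq_sum_univ, Fin.sum_univ_four]
  by_cases h2 : 4 ≤ e 2
  · exact mem_of _ _ (Finsupp.single_le_iff.mpr h2) hm2
  by_cases h3 : 4 ≤ e 3
  · exact mem_of _ _ (Finsupp.single_le_iff.mpr h3) hm3
  have h22 : 2 ≤ e 2 := by omega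
  have h32 : 2 ≤ e 3 := by omega
  refine mem_of _ _ (Finsupp.le_def.mpr fun j => ?_) hm23
  fin_cases j <;> simp <;> omega

/-- [OURS · L1 W4.6] **The state is ISOLATED** (`(∂a) ⊇ 𝔪⁵`). [folklore] -/
theorem isol_of_ser_eq_fourImp [CharP κ 2] {t : κ} {c : (Fin 4 → ℕ) → κ}
    (hc : ser 2 4 κ c = X 0 * X 1 + X 2 ^ 3 + t • (X 2 * X 3 ^ 2) + X 3 ^ 5) : Isol 2 4 κ c := by
  rw [isol_iff_finite_pderiv, hc]
  exact finite_quot_mono (maximalIdeal_pow_five_le_jac_fourImp t)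
    (Literature.RingTheory.MvPowerSeries.Jets.finite_quotient_maximalIdeal_pow 5)

/-! ## The polar matrix, the polars and the tangent cubic -/

/-- The polar matrix of `u₀u₁ + u₂³ + t·u₂u₃² + u₃⁵`: entry `1` at `(0,1)` and `(1,0)`, `0` elsewhere.
[folklore] -/
theorem polarMatrix_fourImp_apply (t : κ) (s s' : Fin 4) :
    polarMatrix ((X 0 * X 1 + X 2 ^ 3 + t • (X 2 * X 3 ^ 2) + X 3 ^ 5 : MvPowerSeries (Fin 4) κ)) s s' =
      if (s = 0 ∧ s' = 1) ∨ (s = 1 ∧ s' = 0) then 1 else 0 := by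
  simp only [polarMatrix, Matrix.of_apply]
  by_cases hst : s = s'
  · subst hst
    rw [if_pos rfl, if_neg]
    rintro (⟨h0, h1⟩ | ⟨h1, h0⟩) <;> exact absurd (h0.symm.trans h1) (by decide)
  rw [if_neg hst, coeff_fourImp]
  have h1 : (Finsupp.single s 1 + Finsupp.single s' 1 : Fin 4 →₀ ℕ) ≠ Finsupp.single 2 3 := by
    intro h
    have hd := congrArg Finsupp.degree h
    simp only [map_add, Finsupp.degree_single] at hd
    omega
  have h2 : (Finsupp.single s 1 + Finsupp.single s' 1 : Fin 4 →₀ ℕ) ≠ Finsupp.single 2 1 + Finsupp.single 3 2 := by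
    intro h
    have hd := congrArg Finsupp.degree h
    simp only [map_add, Finsupp.degree_single] at hd
    omega
  have h3 : (Finsupp.single s 1 + Finsupp.single s' 1 : Fin 4 →₀ ℕ) ≠ Finsupp.single 3 5 := by
    intro h
    have hd := congrArg Finsupp.degree h
    simp only [map_add, Finsupp.degree_single] at hd
    omega
  rw [if_neg h1, if_neg h2, if_neg h3, mul_zero, add_zero, add_zero, add_zero]
  by_cases h01 : (s = 0 ∧ s' = 1) ∨ (s = 1 ∧ s' = 0)
  · rw [if_pos h01, if_pos]
    rcases h01 with ⟨rfl, rfl⟩ | ⟨rfl, rfl⟩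
    · rfl
    · rw [add_comm]
  · rw [if_neg h01, if_neg]
    intro h
    apply h01
    have hs := DFunLike.congr_fun h s
    have ht := DFunLike.congr_fun h s'
    simp only [Finsupp.coe_add, Pi.add_apply, Finsupp.single_eq_same, Finsupp.single_apply] at hs ht
    fin_cases s <;> fin_cases s' <;> simp_all

/-- [OURS · L1 W4.6] **The kernel of the polar matrix of `u₀u₁ + u₂³ + t·u₂u₃² + u₃⁵` IS `{v₀ = v₁ = 0}`.**
[folklore] -/
theorem vecMul_polarMatrix_fourImp_eq_zero_iff (t : κ) (w : Fin 4 → κ) :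
    Matrix.vecMul w (polarMatrix ((X 0 * X 1 + X 2 ^ 3 + t • (X 2 * X 3 ^ 2) + X 3 ^ 5 : MvPowerSeries (Fin 4) κ))) = 0 ↔
      w 0 = 0 ∧ w 1 = 0 := by
  have hv : ∀ s' : Fin 4, Matrix.vecMul w
      (polarMatrix ((X 0 * X 1 + X 2 ^ 3 + t • (X 2 * X 3 ^ 2) + X 3 ^ 5 : MvPowerSeries (Fin 4) κ))) s' =
        if s' = 0 then w 1 else if s' = 1 then w 0 else 0 := by
    intro s'
    rw [Matrix.vecMul, dotProduct, Fin.sum_univ_four, polarMatrix_fourImp_apply, polarMatrix_fourImp_apply,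
      polarMatrix_fourImp_apply, polarMatrix_fourImp_apply]
    fin_cases s' <;> simp
  constructor
  · intro h
    have h0 := congrFun h 1
    have h1 := congrFun h 0
    rw [hv, Pi.zero_apply] at h0 h1
    simp only [Fin.isValue, one_ne_zero, ↓reduceIte] at h0 h1
    exact ⟨h0, h1⟩
  · rintro ⟨h0, h1⟩
    funext s'
    rw [hv, Pi.zero_apply, h0, h1]
    split_ifs <;> rfl

/-- [OURS · L1 W4.6] THE POLARS of `u₀u₁ + u₂³ + t·u₂u₃² + u₃⁵`: `Σₛ λₛ (∂ₛa)₂(v) = λ₂ (v₂² + t·v₃²)` for ALL `λ, v`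
(`(∂₂a)₂ = u₂² + t u₃²`; `∂₀a, ∂₁a` are linear, `∂₃a = u₃⁴` has no quadratic part). [folklore] -/
theorem polar_fourImp [CharP κ 2] (t : κ) (lam v : Fin 4 → κ) :
    ∑ s, lam s * degForm 2 (MvPowerSeries.pderiv s
        ((X 0 * X 1 + X 2 ^ 3 + t • (X 2 * X 3 ^ 2) + X 3 ^ 5 : MvPowerSeries (Fin 4) κ))) v =
      lam 2 * (v 2 ^ 2 + t * v 3 ^ 2) := by
  have hX : ∀ s' : Fin 4, degForm 2 (X s' : MvPowerSeries (Fin 4) κ) v = 0 := fun s' => by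
    rw [X_def, degForm_monomial_of_ne (by rw [Finsupp.degree_single]; norm_num)]
  have hsq : ∀ s' : Fin 4, degForm 2 ((X s' : MvPowerSeries (Fin 4) κ) ^ 2) v = v s' ^ 2 := fun s' => by
    rw [X_pow_eq, degForm_monomial (by rw [Finsupp.degree_single]), Fin.prod_univ_four]
    fin_cases s' <;> simp
  have h4 : degForm 2 ((X 3 : MvPowerSeries (Fin 4) κ) ^ 4) v = 0 := by
    rw [X_pow_eq, degForm_monomial_of_ne (by rw [Finsupp.degree_single]; norm_num)]
  rw [Fin.sum_univ_four, pderiv_fourImp, pderiv_fourImp, pderiv_fourImp, pderiv_fourImp]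
  simp only [Fin.isValue, ↓reduceIte, one_ne_zero, show (2 : Fin 4) ≠ 0 by decide, show (2 : Fin 4) ≠ 1 by decide,
    show (3 : Fin 4) ≠ 0 by decide, show (3 : Fin 4) ≠ 1 by decide, show (3 : Fin 4) ≠ 2 by decide]
  rw [hX, hX, degForm_add, degForm_smul, hsq, hsq, h4]
  ring

/-- [OURS · L1 W4.6] The tangent cubic of `u₀u₁ + u₂³ + t·u₂u₃² + u₃⁵` is `w₂³ + t·w₂w₃²`. [folklore] -/
theorem degForm_three_fourImp (t : κ) (w : Fin 4 → κ) :
    degForm 3 ((X 0 * X 1 + X 2 ^ 3 + t • (X 2 * X 3 ^ 2) + X 3 ^ 5 : MvPowerSeries (Fin 4) κ)) w =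
      w 2 ^ 3 + t * (w 2 * w 3 ^ 2) := by
  rw [degForm_add, degForm_add, degForm_add, degForm_smul, X_pow_eq, X_pow_eq, X_pow_eq, X_def, X_def, X_def,
    monomial_mul_monomial, monomial_mul_monomial, one_mul,
    degForm_monomial_of_ne (by rw [map_add, Finsupp.degree_single, Finsupp.degree_single]; norm_num),
    degForm_monomial (by rw [Finsupp.degree_single]),
    degForm_monomial (by rw [map_add, Finsupp.degree_single, Finsupp.degree_single]),
    degForm_monomial_of_ne (by rw [Finsupp.degree_single]; norm_num), Fin.prod_univ_four, Fin.prod_univ_four]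
  simp

end CampaignW46.HypersurfacesCharTwo

end Summit.ResolutionOfSingularities.ResolutionOfSingularities.Theorems

end
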